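import Literature.MathematicalPhysics.QuantumFieldTheory.Balaban1983to89.Node00.CriticalOnFibre
import Literature.MathematicalPhysics.QuantumFieldTheory.Balaban1983to89.Node00.AveragingSmooth
import Literature.MathematicalPhysics.QuantumFieldTheory.Balaban1983to89.Node00.LargeFieldBackgroundCoPOfRecord

/-!
# `Balaban1983to89.B15Prop1ClassOpenAtRecord` — [Balaban1985RegularSpaces] (1.7), (1.9) p. 77 (STRICT inequalities); [Balaban1985Variational] (2), (6) p. 278; [Balaban1988Convergent] (2.12) p. 256:
# PRINT'S CLASS (6) OF RECORD IS OPEN IN THE MATRIX TOPOLOGY — the letter `hclass` of `B15Prop1LocalChartAtBaseField.exists_localChart_at_baseField` DISCHARGED at NODE 00's class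
# `regMSCoPOfRecord[At]`

Honest framing: statement-level skeleton of published theorems with citation tags; proofs where landed; nothing here is a claim about the
Yang–Mills mass gap.  Cell `pub-ymgap`, HUMAN RULING D-0149 (width seats), seat `pub-ymgap-dag-n12-w1` (g2; N12 = [B15]; U1a⁺ of the w1 lineage);
count-neutral; N12 NOT discharged; finite 𝕋⁴ at fixed ε; nothing continuum ∕ OS ∕ mass-gap ∕ Clay.

WHY.  The local-chart theorem of this lineage asks, per base field, `hclass : ∀ᶠ Q in 𝓝 ↑U₀, ∀ U′, ↑U′ = Q → U′ ∈ reg` — the class is open at `U₀` IN THE TOPOLOGY OF MATRIX FIELDS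
(the implicit family lives there).  n07-e proved curve-openness of (1.7) and (1.9) in the topology of `SU(N)`-configurations (`Node00.eventually_plaqSmallOn`, `eventually_coDivSmallOn`);
the passage to matrix fields is that `U ↦ ↑U` (`coeField`) is a topological EMBEDDING (`Topology.IsInducing.piMap` of `Subtype.val`), so neighbourhoods pull back (`Filter.eventually_comap`).

CONTENTS (theorems only; no `def`, no `instance`, no `sorry`).  §1 `isInducing_coeField`, ★ `eventually_coeField_of_eventually` (generic: any property eventually true near `U₀` among
`SU(N)` configurations is eventually true, near `↑U₀`, for all configurations with that matrix field).  §2 `eventually_mem_regMSCoPOfRecordAt` (NODE 00's class on a support is open),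
★★ `hclass_regMSCoPOfRecordAt`, `hclass_regMSCoPOfRecord` (the letter `hclass` at the class of record, for any member `U₀`).
-/

noncomputable section

namespace Literature.MathematicalPhysics.QuantumFieldTheory.Balaban1983to89.B15Prop1ClassOpenAtRecord

open Filter Topology
open Literature.MathematicalPhysics.QuantumFieldTheory.Balaban1983to89.Node00 (SU coeField coeField_apply eventually_plaqSmallOn eventually_coDivSmallOn regMSCoPOfRecordAt
  regMSCoPOfRecord Stage7Numerics)
open T4Continuum B15DeterminingSets GaugeField
open scoped Matrix.Norms.L2Operator

/-! ## §1  `U ↦ ↑U` is an embedding: eventual statements pull back to the matrix topology -/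

section Embedding

variable {P : Params} {j N : ℕ}

/-- **`coeField` IS INDUCING** (the product of the subtype embeddings `SU(N) ↪ M_N(ℂ)`). [cite: Balaban1987RG1, (0.2) p.252 (bookkeeping)] -/
theorem isInducing_coeField : IsInducing (coeField : GaugeField P j (SU N) → PBond P j → Matrix (Fin N) (Fin N) ℂ) :=
  Topology.IsInducing.piMap fun _ : PBond P j => Topology.IsInducing.subtypeVal

/-- ★ **EVENTUAL STATEMENTS PULL BACK TO THE MATRIX TOPOLOGY**: if `p` holds for all `SU(N)` configurations near `U₀`, then near the matrix field `↑U₀` every configuration `U` with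
`↑U = Q` satisfies `p` — the shape of the letters `hclass` ∕ `hκreal` ∕ `eventually_smallBelow` of this lineage. [cite: Balaban1985RegularSpaces, (1.7),(1.9) p.77 (bookkeeping)] -/
theorem eventually_coeField_of_eventually {p : GaugeField P j (SU N) → Prop} {U₀ : GaugeField P j (SU N)} (h : ∀ᶠ U in 𝓝 U₀, p U) :
    ∀ᶠ Q in 𝓝 (coeField U₀), ∀ U : GaugeField P j (SU N), coeField U = Q → p U := by
  rw [isInducing_coeField.nhds_eq_comap] at h
  exact Filter.eventually_comap.1 h

end Embedding

/-! ## §2  NODE 00's class of record is open; the letter `hclass` -/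

section Record

variable (F : T4Family) (N : ℕ) [NeZero N]

/-- **PRINT'S CLASS (6) ON A SUPPORT IS OPEN** (finitely many STRICT inequalities (1.7), (1.9) in continuous functions of the configuration): every configuration near a member is
a member. [cite: Balaban1985RegularSpaces, (1.7),(1.9) p.77; Balaban1985Variational, (2),(6) p.278] -/
theorem eventually_mem_regMSCoPOfRecordAt (ν : Stage7Numerics) (K k : ℕ) (Ω₀ : Set (Site (F.P K) 0)) (Ω : ℕ → Set (Site (F.P K) 0))
    {U₀ : GaugeField (F.P K) 0 (SU N)} (hU₀ : U₀ ∈ regMSCoPOfRecordAt F N ν K k Ω₀ Ω) :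
    ∀ᶠ U in 𝓝 U₀, U ∈ regMSCoPOfRecordAt F N ν K k Ω₀ Ω := by
  have hγ : ContinuousAt (fun (U : GaugeField (F.P K) 0 (SU N)) (b : PBond (F.P K) 0) => U b) U₀ := continuousAt_id
  have h1 : ∀ i : Fin (k + 1), ∀ᶠ U in 𝓝 U₀,
      PlaqSmallOn (B8Eq17ClassAkV1.plaqsOf (Node00.topSeq Ω₀ Ω i)) (ν.εreg * (F.P K).eta i ^ 2) U :=
    fun i => eventually_plaqSmallOn (γ := fun U : GaugeField (F.P K) 0 (SU N) => U) hγ (hU₀.1 i (Nat.lt_succ_iff.mp i.2))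
  have h2 : ∀ i : Fin (k + 1), ∀ᶠ U in 𝓝 U₀,
      Node00.Sect2.CoDivSmallOn (bondsOf (Node00.topSeq Ω₀ Ω i)) (ν.εreg * (F.P K).eta i ^ 3) U :=
    fun i => eventually_coDivSmallOn (γ := fun U : GaugeField (F.P K) 0 (SU N) => U) hγ (hU₀.2 i (Nat.lt_succ_iff.mp i.2))
  filter_upwards [eventually_all.2 h1, eventually_all.2 h2] with U hU1 hU2
  exact ⟨fun j hj => hU1 ⟨j, Nat.lt_succ_of_le hj⟩, fun j hj => hU2 ⟨j, Nat.lt_succ_of_le hj⟩⟩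

/-- ★★ **THE LETTER `hclass` AT NODE 00's CLASS ON A SUPPORT**: for any member `U₀`, near the matrix field `↑U₀` every `SU(N)` configuration with that matrix field lies in the class.
[cite: Balaban1985RegularSpaces, (1.7),(1.9) p.77; Balaban1985Variational, (6) p.278; Balaban1988Convergent, (2.12) p.256] -/
theorem hclass_regMSCoPOfRecordAt (ν : Stage7Numerics) (K k : ℕ) (Ω₀ : Set (Site (F.P K) 0)) (Ω : ℕ → Set (Site (F.P K) 0))
    {U₀ : GaugeField (F.P K) 0 (SU N)} (hU₀ : U₀ ∈ regMSCoPOfRecordAt F N ν K k Ω₀ Ω) :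
    ∀ᶠ Q in 𝓝 (coeField U₀), ∀ U : GaugeField (F.P K) 0 (SU N), coeField U = Q → U ∈ regMSCoPOfRecordAt F N ν K k Ω₀ Ω :=
  eventually_coeField_of_eventually (eventually_mem_regMSCoPOfRecordAt F N ν K k Ω₀ Ω hU₀)

/-- **THE LETTER `hclass` AT THE CLASS OF RECORD** `regMSCoPOfRecord F N ν K k Ω` (the support of record). [cite: Balaban1985Variational, (6) p.278; Balaban1988Convergent, p.255, (2.12) p.256] -/
theorem hclass_regMSCoPOfRecord (ν : Stage7Numerics) (K k : ℕ) (Ω : ℕ → Set (Site (F.P K) 0))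
    {U₀ : GaugeField (F.P K) 0 (SU N)} (hU₀ : U₀ ∈ regMSCoPOfRecord F N ν K k Ω) :
    ∀ᶠ Q in 𝓝 (coeField U₀), ∀ U : GaugeField (F.P K) 0 (SU N), coeField U = Q → U ∈ regMSCoPOfRecord F N ν K k Ω :=
  hclass_regMSCoPOfRecordAt F N ν K k _ Ω hU₀

end Record

end Literature.MathematicalPhysics.QuantumFieldTheory.Balaban1983to89.B15Prop1ClassOpenAtRecord

end
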